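import Mathlib
import Summits.Ventures.HSemireg.SheafSeedOnAnchor

/-!
# AlphaTooth — embed g16, LIMITED MANDATE (α) (director-hodge R19.455 (1)(d)): the first K-sensitive object of the (α) row

Evidence file for `stmt-HodgeConjecture-18881` (D-0145 line `Cruxes/BlochSeedDiscOne/Lines/birth.lean`, stub
`stub_rung_pad4_seedAt` untouched).  Census-neutral; nothing here is proved toward HC ∕ HC_CM ∕ HC_AV ∕ №4 ∕ 26512 ∕ 18881 ∕ H2.
The typed HOME of everything in this file is the ω-anchor `Summit.Ventures.HSemireg.HasHyperbolicBFSheafSeedOn C 4 3 I`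
(d = 3), never 18881 (d = 1) — and the dichotomy below is the kernel reason WHY it can never be 18881.

THE OBJECT («one-point Koszul tooth»).  On S = E_K², E_K = ℂ∕O_K, a LETTER is the fibre class ℓ_v of a primitive
v ∈ O_K² (ℓ_v = v v*, null); it is CHARGE-CAPABLE (= equatorial = non-polar with |v₁| = |v₂|, the only letters that can sit
in a μ-carrying cell: g12 THEOREM NP ∕ Möbius rigidity) iff N(v₁) = N(v₂).  Two letters meet in ℓ_v · ℓ_w = N(det(v,w)) points.
`MeetOnce? v w` := both equatorial and N(det) = 1, i.e. the two elliptic curves cut out ONE reduced point, i.e. the Koszul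
complex 𝒪(−ℓ_v − ℓ_w) → 𝒪(−ℓ_v) ⊕ 𝒪(−ℓ_w) resolves the ideal of a point, i.e. ℓ_v + ℓ_w is a PRINCIPAL polarisation Θ′
lying in the positive cone of the charge-capable letter lattice (the (α)-block `u_j + u_{j+1}` of ONE-HUB-LINE28 §6∕§9).

THE DICHOTOMY (kernel, below):
* `omega_meet_once`  — K = ℚ(ω): v = (1,1), w = (1, 1+ω) = (1, ζ₆) meet once (det = ω, N(ω) = 1).
* `gauss_meet_even`  — K = ℚ(i): ANY two equatorial vectors with odd norms (⊇ all primitive equatorial ones: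
  `gauss_primitive_odd`) meet in an EVEN number of points (reduction mod the ramified prime (1+i));
  hence `gauss_not_meet_once`.
So the (α) alphabet of the ω-frame contains charge-capable one-point Koszul pairs ∕ principal rank-2 blocks and the
i-frame's does not: the first object of the whole E4 programme that «change the CM» changes.  What it would say about a
SEED if it bites: see ALPHA-TOOTH-embed-g16.md §3 (one line: an (α)-room built on Θ′-blocks is a candidate realisation of
`HasHyperbolicBFSheafSeedOn C 4 3 I` whose i-frame shadow does not exist — so it cannot be refuted by transporting an
i-frame no-go, and cannot be transported to 18881).  Cheapest falsifier: the TWO-RAY LAW (memo §2), pen.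
-/

set_option linter.dupNamespace false

namespace Summit.HodgeConjecture.HodgeConjecture.Cruxes.BlochSeedDiscOne.EmbedG16Alpha

/-! ## ℤ[i] and ℤ[ω] in coordinates (no instances, no notation) -/

/-- `N(p + q i) = p² + q²`. -/
def nG (x : ℤ × ℤ) : ℤ := x.1 ^ 2 + x.2 ^ 2
/-- product in `ℤ[i]`. -/
def mulG (x y : ℤ × ℤ) : ℤ × ℤ := (x.1 * y.1 - x.2 * y.2, x.1 * y.2 + x.2 * y.1)
/-- `N(p + q ω) = p² − p q + q²` (`ω² + ω + 1 = 0`). -/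
def nE (x : ℤ × ℤ) : ℤ := x.1 ^ 2 - x.1 * x.2 + x.2 ^ 2
/-- product in `ℤ[ω]`: `(p+qω)(p'+q'ω) = (pp' − qq') + (pq' + qp' − qq') ω`. -/
def mulE (x y : ℤ × ℤ) : ℤ × ℤ := (x.1 * y.1 - x.2 * y.2, x.1 * y.2 + x.2 * y.1 - x.2 * y.2)
/-- coordinatewise difference. -/
def sub2 (x y : ℤ × ℤ) : ℤ × ℤ := (x.1 - y.1, x.2 - y.2)
/-- `det(v, w) = v₁ w₂ − w₁ v₂` over `ℤ[i]`. -/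
def detG (v w : (ℤ × ℤ) × (ℤ × ℤ)) : ℤ × ℤ := sub2 (mulG v.1 w.2) (mulG w.1 v.2)
/-- `det(v, w) = v₁ w₂ − w₁ v₂` over `ℤ[ω]`. -/
def detE (v w : (ℤ × ℤ) × (ℤ × ℤ)) : ℤ × ℤ := sub2 (mulE v.1 w.2) (mulE w.1 v.2)

/-- two EQUATORIAL (charge-capable) vectors of `ℤ[i]²` whose letters meet in ONE point. -/
def MeetOnceG (v w : (ℤ × ℤ) × (ℤ × ℤ)) : Prop :=
  nG v.1 = nG v.2 ∧ nG w.1 = nG w.2 ∧ nG (detG v w) = 1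
/-- two EQUATORIAL (charge-capable) vectors of `ℤ[ω]²` whose letters meet in ONE point. -/
def MeetOnceE (v w : (ℤ × ℤ) × (ℤ × ℤ)) : Prop :=
  nE v.1 = nE v.2 ∧ nE w.1 = nE w.2 ∧ nE (detE v w) = 1

/-! ## The ω-side: adjacent unit letters meet once -/

/-- **ω-frame witness:** `v = (1, 1)` (unit ray `u₀`) and `w = (1, 1+ω) = (1, ζ₆)` (unit ray `u₁`) are equatorial and
`det = ω`, `N(ω) = 1`: the letters `u₀, u₁` of `E_ω²` meet in ONE point; `u₀ + u₁` is a principal polarisation. -/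
theorem omega_meet_once : MeetOnceE ((1, 0), (1, 0)) ((1, 0), (1, 1)) := by
  refine ⟨by decide, by decide, by decide⟩

/-- the sandwich identity behind it: for unit rays at angle `60°`, `ℓ·ℓ′ = |ζ₆ − 1|² = N(ω) = 1`. -/
theorem nE_omega : nE (0, 1) = 1 := by decide

/-! ## The i-side: a parity wall (the prime (1+i) is ramified) -/

/-- the mod-2 kernel of the argument: with all eight coordinates read in `ZMod 2`, equatorial + odd norms force the
norm of the determinant to vanish mod 2 (2⁸ cases, `decide`). -/
theorem parity_kernel :
    ∀ a1 a2 b1 b2 c1 c2 d1 d2 : ZMod 2,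
      a1 ^ 2 + a2 ^ 2 = b1 ^ 2 + b2 ^ 2 → c1 ^ 2 + c2 ^ 2 = d1 ^ 2 + d2 ^ 2 →
      a1 ^ 2 + a2 ^ 2 = 1 → c1 ^ 2 + c2 ^ 2 = 1 →
      (a1 * d1 - a2 * d2 - (c1 * b1 - c2 * b2)) ^ 2 + (a1 * d2 + a2 * d1 - (c1 * b2 + c2 * b1)) ^ 2 = 0 := by
  decide

/-- an odd integer is `1` in `ZMod 2`. -/
theorem cast_eq_one_of_odd {n : ℤ} (h : Odd n) : (n : ZMod 2) = 1 := by
  obtain ⟨k, rfl⟩ := h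
  push_cast
  have h2 : (2 : ZMod 2) = 0 := by decide
  rw [h2]
  ring

/-- an integer that is `0` in `ZMod 2` is even. -/
theorem even_of_cast_eq_zero {n : ℤ} (h : (n : ZMod 2) = 0) : Even n := by
  have h2 : (2 : ℤ) ∣ n := (ZMod.intCast_zmod_eq_zero_iff_dvd n 2).1 h
  exact even_iff_two_dvd.2 h2

/-- **i-frame parity wall:** two equatorial vectors of `ℤ[i]²` with odd norms meet in an EVEN number of points. -/
theorem gauss_meet_even (v w : (ℤ × ℤ) × (ℤ × ℤ)) (hv : nG v.1 = nG v.2) (hw : nG w.1 = nG w.2)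
    (hvo : Odd (nG v.1)) (hwo : Odd (nG w.1)) : Even (nG (detG v w)) := by
  apply even_of_cast_eq_zero
  have hv' := congrArg (Int.cast : ℤ → ZMod 2) hv
  have hw' := congrArg (Int.cast : ℤ → ZMod 2) hw
  have hvo' := cast_eq_one_of_odd hvo
  have hwo' := cast_eq_one_of_odd hwo
  simp only [nG, detG, mulG, sub2] at hv' hw' hvo' hwo' ⊢
  push_cast at hv' hw' hvo' hwo' ⊢
  exact parity_kernel _ _ _ _ _ _ _ _ hv' hw' hvo' hwo'

/-- primitivity forces odd norms for an equatorial vector of `ℤ[i]²`: if `N(v₁) = N(v₂)` is even then `(1+i)` divides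
both coordinates — stated contrapositively in coordinates: `N(v₁)` even ⇒ both `v₁`, `v₂` lie in `(1+i)ℤ[i]`
(`p ≡ q (mod 2)`), so `v` is not primitive.  Hence every PRIMITIVE equatorial `v` has `N(v₁)` odd. -/
theorem gauss_primitive_odd (v : (ℤ × ℤ) × (ℤ × ℤ)) (hv : nG v.1 = nG v.2) (he : Even (nG v.1)) :
    (2 : ℤ) ∣ (v.1.1 - v.1.2) ∧ (2 : ℤ) ∣ (v.2.1 - v.2.2) := by
  have key : ∀ p q : ZMod 2, p ^ 2 + q ^ 2 = 0 → p - q = 0 := by decide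
  have he1 : ((nG v.1 : ℤ) : ZMod 2) = 0 := by
    obtain ⟨k, hk⟩ := he
    rw [hk]
    push_cast
    have h2 : (k : ZMod 2) + (k : ZMod 2) = 2 * (k : ZMod 2) := by ring
    rw [h2, show (2 : ZMod 2) = 0 by decide, zero_mul]
  have he2 : ((nG v.2 : ℤ) : ZMod 2) = 0 := by rw [← hv]; exact he1
  simp only [nG] at he1 he2
  push_cast at he1 he2
  constructor
  · apply (ZMod.intCast_zmod_eq_zero_iff_dvd _ 2).1
    push_cast
    exact key _ _ he1
  · apply (ZMod.intCast_zmod_eq_zero_iff_dvd _ 2).1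
    push_cast
    exact key _ _ he2

/-- **hence no one-point Koszul pair of charge-capable letters exists on `E_i²`:** for PRIMITIVE equatorial `v, w`
(odd norms), `¬ MeetOnceG v w`. -/
theorem gauss_not_meet_once (v w : (ℤ × ℤ) × (ℤ × ℤ)) (hvo : Odd (nG v.1)) (hwo : Odd (nG w.1)) :
    ¬ MeetOnceG v w := by
  rintro ⟨hv, hw, h1⟩
  have h := gauss_meet_even v w hv hw hvo hwo
  rw [h1] at h
  exact Int.not_even_one h

/-- **THE DICHOTOMY (the typed (α)-object):** charge-capable one-point Koszul pairs exist over `ℤ[ω]` and do not exist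
over `ℤ[i]` (for primitive = odd-norm vectors). -/
theorem alpha_tooth :
    (∃ v w, MeetOnceE v w) ∧ (∀ v w, Odd (nG v.1) → Odd (nG w.1) → ¬ MeetOnceG v w) :=
  ⟨⟨_, _, omega_meet_once⟩, gauss_not_meet_once⟩


/-! ## Block determinants: the parity wall on the charge-capable unit lattice of `E_i²` vs the principal block of `E_ω²` -/

/-- determinant (= Euler characteristic = self-intersection∕2) of the unit-letter block `Σ_j m_j u_j` on `E_i²`,
`u_j = ℓ_{i^j}`: the Hermitian matrix `[[s, β̄],[β, s]]`, `s = Σ m_j`, `β = Σ m_j i^j = (m₀ − m₂) + (m₁ − m₃) i`. -/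
def detUnitBlockG (m0 m1 m2 m3 : ℤ) : ℤ := (m0 + m1 + m2 + m3) ^ 2 - nG (m0 - m2, m1 - m3)

/-- determinant of the unit-letter block `Σ_j m_j u_j` on `E_ω²`, `u_j = ℓ_{ζ₆^j}`, `ζ₆ = 1 + ω`:
`β = Σ m_j ζ₆^j` with `ζ₆^0..ζ₆^5 = 1, 1+ω, ω, −1, −1−ω, −ω` in `ℤ[ω]`-coordinates. -/
def detUnitBlockE (m0 m1 m2 m3 m4 m5 : ℤ) : ℤ :=
  (m0 + m1 + m2 + m3 + m4 + m5) ^ 2 - nE (m0 + m1 - m3 - m4, m1 + m2 - m4 - m5)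

/-- **parity wall (i-frame):** every block in the unit-letter lattice of `E_i²` has EVEN determinant — no principal
(det 1) block, in particular `det(u_j + u_{j+1}) = 2`. -/
theorem gauss_unit_block_det_even (m0 m1 m2 m3 : ℤ) : Even (detUnitBlockG m0 m1 m2 m3) := by
  apply even_of_cast_eq_zero
  have key : ∀ a b c d : ZMod 2, (a + b + c + d) ^ 2 - ((a - c) ^ 2 + (b - d) ^ 2) = 0 := by decide
  simp only [detUnitBlockG, nG]
  push_cast
  exact key _ _ _ _

/-- the i-frame adjacent-unit block `u₀ + u₁` has determinant `2`. -/
theorem gauss_adjacent_block_det : detUnitBlockG 1 1 0 0 = 2 := by decide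

/-- **the ω-frame principal block:** `det(u₀ + u₁) = 4 − N(2 + ω) = 4 − 3 = 1` on `E_ω²`. -/
theorem omega_adjacent_block_det : detUnitBlockE 1 1 0 0 0 0 = 1 := by decide

/-- and the other ω-pairs: `det(u₀ + u₂) = 3`, `det(u₀ + u₃) = 4` (so `Θ′ := u_j + u_{j+1}` is the unique principal pair). -/
theorem omega_other_pairs_det : detUnitBlockE 1 0 1 0 0 0 = 3 ∧ detUnitBlockE 1 0 0 1 0 0 = 4 := by
  refine ⟨by decide, by decide⟩

/-- `u₀ + u₂ + u₄ = 3·h_f` (`β = 1 + ω + ω² = 0`, `s = 3`; `h_f = θ_A + θ_B` the product principal polarisation of the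
factor): `det = 9` — the alternate unit triple is a multiple of `h_f`, as on the μ₄ side `u₀ + u₂ = 2·h_f`. -/
theorem omega_three_alternate_det : detUnitBlockE 1 0 1 0 1 0 = 9 := by decide

/-! ## The typed home (statement only; d = 3) -/

/-- **The (α)-row's typed target, in the ω-anchor home (d = 3), STATED NOT PROVED** — a hyperbolic Buchweitz–Flenner
sheaf seed at level 4 for `K = ℚ(√-3)` on SOME index set containing the Weil degree 4.  The (α) programme (two-term rooms
whose cells carry principal rank-2 blocks Θ′ = u_j + u_{j+1}, available by `alpha_tooth.1`) is a candidate realisation;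
by `alpha_tooth.2` it has no i-frame shadow, so it neither transports to `HasHyperbolicBlochSeed 4 1` (18881) nor is it
refuted by transporting an i-frame no-go.  This `def` is a TARGET TYPE, not a claim. -/
def AlphaOmegaSeedTarget (C : Literature.AlgebraicGeometry.HodgeTheory.ChernCharacterBetti) : Prop :=
  ∃ I : Finset ℕ, 4 ∈ I ∧ Summit.Ventures.HSemireg.HasHyperbolicBFSheafSeedOn C 4 3 I

end Summit.HodgeConjecture.HodgeConjecture.Cruxes.BlochSeedDiscOne.EmbedG16Alpha
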